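import Mathlib
import Literature.MathematicalPhysics.QuantumFieldTheory.Balaban1983to89.Beta.PolarizationSign
import Literature.MathematicalPhysics.QuantumFieldTheory.Balaban1983to89.Beta.InfiniteVolume
import Literature.MathematicalPhysics.QuantumFieldTheory.Balaban1983to89.Beta.VolumeConvolution

/-!
# `Balaban1983to89.Beta.PolarizationLimit` — the HYPOTHESES of the β sub-cell's sign lemma pass to the limit
# `T ↗ ℤ^d`: torus-side Ward identity / PSD / reflection covariance + pointwise convergence ⇒ the `ℤ^d` predicates
# of `Beta/PolarizationSign.lean`, hence `β ≥ 0` for the limit kernel and `0 ≤ β⁰_k` over the one-loop dictionary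

T. Bałaban, *Renormalization group approach to lattice gauge field theories. I. Generation of effective actions in a
small field approximation and a coupling constant renormalization in four dimensions*, Commun. Math. Phys. **109**,
249–301 (1987) [Balaban1987RG1] (cell paper B12; PDF page = journal page − 248; PDF held:
`paper:balaban1987-cmp109-rg-i-small-field`).

HONEST FRAMING (BETA-SPEC.md, verbatim): discharging `BetaPertH` makes Bałaban's UV stability UNCONDITIONAL — a real
constructive-QFT result; it is NOT the continuum limit and NOT the Clay problem.  THIS MODULE DISCHARGES NOTHING of the
series.  It is KERNEL-CHECKED BOOKKEEPING (unit `b2b-balaban-pv09` gen 3, journal node `BETA-an2-LEMMA52-LIMIT-KERNEL`,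
the follow-up (k4) of node (k3) = `Beta/PolarizationSign.lean`): elementary facts about pointwise limits of finite sums.
Value = one more typed edge of the β sub-cell's DAG, NOT summit progress.

CITATION HEADER (lean-in-tree rule 2026-08-18).  NO NEW QUOTATION is introduced by this module.  The printed sentences
it is ABOUT are quoted verbatim in the headers of the two modules it joins, and are re-used from there:
* p. 264 [PDF 16], after (1.21): *"Now we take a limit of these functions as T^{(j+1)} ↗ Z^d. This limit exists by the
  localized representation (1.7)."* — typed by pv25 as the PREDICATE `Beta.IsInfiniteVolumeLimit` (`Beta/OneLoop.lean`),
  developed by pv01 gen 3 in `Beta/InfiniteVolume.lean` (window dictionary, `UniformDecay`, `decay510_of_isInfiniteVolumeLimit`,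
  `tendsto_torusSecondMoment`); (1.22) *"… = Σ_x Π_{j+1,μν}(g_j, x) x_μ x_ν (1.22) for μ, ν arbitrary, μ ≠ ν"* —
  `B12Beta.secondMoment`.
* p. 293 [PDF 45], (5.7) *"Π_{μν}(εx − ((1−ε_μ)/2)e_μ, εy − ((1−ε_ν)/2)e_ν) = ε_μ ε_ν Π_{μν}(x, y)"*, (5.8) *"Π_{μν}(x, y) =
  Π_{μν}(x − y), Π_{μν}(x) = Π_{νμ}(−x)"*, (5.9) *"Σ_μ ∂*_μ Π_{μν}(x − y) = Σ_ν ∂_ν Π_{μν}(x − y) = 0"*, (5.10) *"|Π_{μν}(x − y)|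
  ≦ O(1)E₀ exp(−δ₁|x − y|)"* — typed by this seat as the PREDICATES `AxisReflectionCovariant`, `IndexSymmetric`,
  `WardTransversal`, `MomentSummable` on `ℤ^d` kernels (`Beta/PolarizationSign.lean`, node (k3), p178805; quotations
  there, read from the render `…/1987-cmp109-rg-I-small-field-p045-x2.png`), next to the NOT-printed hypothesis
  `ConvPSD` / `TorusConvPSD` (positive semi-definiteness of the convolution form — hypothesis (ii) of the β sub-cell's
  programme-internal "Lemma 5.2" / "Lemma T", `HOME/BETA/AN2-pv09.md` §5, `HOME/BETA/AN2.md` §4.2; those prose files are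
  NOT cited as sources of facts — cell rule).
Print states (5.7)–(5.10) for the kernel `Π_{μν}(g_k, ·)` of §5, which by (5.1) p. 292 is an infinite-volume limit,
while the objects a construction (or row num's computation) actually produces live on finite tori `T^{(j+1)}` ((0.1)
p. 251).  Which side carries which property is therefore a DICTIONARY question of the β sub-cell (GAPS G-beta-4,
AN2-pv09 (V)/(T)); this module settles the purely formal half of it: the four structural properties, if they hold on
the tori (eventually in the volume), hold for any pointwise limit.  Nothing printed is asserted; every torus-side
property below is a `Prop` used only to the left of `→`.

WHAT IS PROVED (0 sorry; Mathlib + the cell modules imported, all by name):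
(1) §1 TORUS-SIDE PREDICATES on kernels `P : Fin d → Fin d → Beta.Site d s → ℝ` (`Site d s = (ZMod s)^d`, pv25):
    `torusUnitVec`, `TorusWardTransversal` (Σ_μ [P_{μν}(x − ê_μ) − P_{μν}(x)] = 0), `torusAxisReflect`,
    `TorusAxisReflectionCovariant` (P_{μν}(εx − [μ=α]ê_α + [ν=α]ê_α) = ε_με_ν P_{μν}(x)), `TorusIndexSymmetric`
    (P_{μν}(x) = P_{νμ}(−x)); `TorusConvPSD` is (k3)'s.  They are the images of the `ℤ^d` predicates under the residue
    map `Beta.siteOf d s : ℤ^d → (ZMod s)^d` (§2: `siteOf_unitVec`, `siteOf_axisReflect`; additivity `siteOf_add`,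
    `siteOf_neg`, `siteOf_sub` is pv04 gen 3's, `Beta/VolumeAffine.lean` / `Beta/VolumeConvolution.lean`, by name).
(2) §3 CLOSEDNESS UNDER THE LIMIT.  For torus kernels `P t` on sides `side t`, a kernel `Pinf` on `ℤ^d` and pv25's
    `IsInfiniteVolumeLimit side P Pinf` (pointwise convergence `P t μ ν (siteOf x) → Pinf μ ν x`):
    `wardTransversal_of_limit` (∀ᶠ t, TorusWardTransversal (P t) ⇒ WardTransversal Pinf),
    `axisReflectionCovariant_of_limit`, `indexSymmetric_of_limit`, and `convPSD_of_limit`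
    (∀ᶠ t, TorusConvPSD (P t) ⇒ ConvPSD Pinf) — the last by pushing a finitely supported `ℤ^d` test function forward
    to the torus FIBREWISE (`pushTest`, `torusForm_pushTest`: the torus form of the push-forward equals the `ℤ^d` form
    read through `siteOf`, for EVERY side `s`, injectivity not needed) and `ge_of_tendsto`.  No decay and no
    `side t → ∞` is used in (2): finite identities and finite PSD forms are closed under pointwise limits.
(3) §4 ASSEMBLY with (k3) and pv01's decay transfer: `secondMoment_nonneg_of_limit` — `side t → ∞`,
    `IsInfiniteVolumeLimit`, `UniformDecay side P C δ` (δ > 0; volume-uniform (5.10), the located UNPRINTED input of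
    G-beta-4, a hypothesis), and eventually-in-`t` torus Ward / PSD / reflection covariance ⇒
    `0 ≤ B12Beta.secondMoment Pinf α β` (α ≠ β), via `PolarizationSign.secondMoment_nonneg_of_decay510` and
    `Beta.decay510_of_isInfiniteVolumeLimit`; `secondMoment_eq_neg_half_of_limit` (β = −½Σ_z Pinf_{ββ}(z) z_α²);
    `eventually_torusSecondMoment_gt` (the torus numbers are eventually `> −ε`, by pv01's `tendsto_torusSecondMoment`);
    and over pv25's hypothesis carrier `D : Beta.OneLoopDictionary d c S` ((1.21) `isLimit`, (1.22) `beta0_eq`):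
    `Beta.OneLoopDictionary.beta0_nonneg_of_torus` — torus-side Ward / PSD / reflection covariance of the one-loop torus
    kernels `torusKernel (D.model k t) a` (eventually in `t`) + volume-uniform decay + `D.side k t → ∞` ⇒ `0 ≤ S.β0 k`.
SCOPE.  (a) The SIGN `0 ≤ β⁰_k` is the weak half of (AF-0); strict / uniform positivity `∃ b > 0` (asymptotic freedom,
T09.F, `BetaPertH`, G1) is untouched.  (b) Whether Bałaban's torus one-loop kernels satisfy the torus-side predicates —
Ward per gauge-invariant piece (AN2 §8.7, `Beta/WardIdentity.lean`), PSD (AN2 §4–§5, `Beta/LogDetVariation.lean` for the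
structurally signed pieces), reflection covariance ((5.7) is printed for the limit kernel; on the torus it is the
Euclidean covariance of the construction, (2.17) p. 269) — is the β sub-cell's analysis, not this file's.  (c) The
existence of the limit ((1.21), G-adv2-2) and the volume-uniform decay (G-beta-4) remain hypotheses exactly as in
`Beta/InfiniteVolume.lean`.
-/

namespace Literature.MathematicalPhysics.QuantumFieldTheory.Balaban1983to89.Beta.PolarizationLimit

open Literature.MathematicalPhysics.QuantumFieldTheory.Balaban1983to89
open Literature.MathematicalPhysics.QuantumFieldTheory.Balaban1983to89.Beta
open Literature.MathematicalPhysics.QuantumFieldTheory.Balaban1983to89.Beta.PolarizationSign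
open Literature.MathematicalPhysics.QuantumFieldTheory.Balaban1983to89.B6BondElimination (unitVec unitVec_apply)
open _root_.Filter
open scoped _root_.Topology

attribute [local simp] Literature.MathematicalPhysics.QuantumFieldTheory.Balaban1983to89.B6BondElimination.unitVec_apply

variable {d : ℕ}

/-! ## §1 Torus-side predicates on `(ZMod s)^d` -/

section Torus

variable {s : ℕ}

/-- The unit vector `ê_μ` of the torus `(ZMod s)^d`. [folklore] -/
def torusUnitVec (μ : Fin d) : Beta.Site d s := fun i => if i = μ then 1 else 0

/-- Components of `ê_μ`. [folklore] -/
@[simp] theorem torusUnitVec_apply (μ i : Fin d) :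
    (torusUnitVec μ : Beta.Site d s) i = if i = μ then 1 else 0 := rfl

/-- Torus-side form of (5.9) p. 293 (first identity, adjoint difference in the contracted first index):
`Σ_μ [P_{μν}(x − ê_μ) − P_{μν}(x)] = 0` for every torus site `x`.  A PREDICATE on an abstract torus kernel.
[cite: Balaban1987RG1, (5.9) p.293] -/
def TorusWardTransversal (P : Fin d → Fin d → Beta.Site d s → ℝ) : Prop :=
  ∀ ν x, ∑ μ, (P μ ν (x - torusUnitVec μ) - P μ ν x) = 0

/-- Reflection of the `α`-th torus coordinate, `(εx)_i = −x_i` if `i = α`, else `x_i` ((5.7) "rx = εx").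
[cite: Balaban1987RG1, (5.7) p.293] -/
def torusAxisReflect (α : Fin d) (x : Beta.Site d s) : Beta.Site d s := fun i => if i = α then -x i else x i

/-- Components of `εx` on the torus. [folklore] -/
@[simp] theorem torusAxisReflect_apply (α : Fin d) (x : Beta.Site d s) (i : Fin d) :
    torusAxisReflect α x i = if i = α then -x i else x i := rfl

/-- Torus-side form of (5.7)–(5.8) p. 293 for the reflection of one axis `α`, in the difference variable:
`P_{μν}(εx − [μ=α]ê_α + [ν=α]ê_α) = ε_μ ε_ν P_{μν}(x)` (`reflSign` is (k3)'s `ε_μ`).  A PREDICATE.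
[cite: Balaban1987RG1, (5.7)-(5.8) p.293] -/
def TorusAxisReflectionCovariant (P : Fin d → Fin d → Beta.Site d s → ℝ) : Prop :=
  ∀ α μ ν x,
    P μ ν (torusAxisReflect α x - (if μ = α then torusUnitVec α else 0) + (if ν = α then torusUnitVec α else 0))
      = reflSign α μ * reflSign α ν * P μ ν x

/-- Torus-side form of (5.8) p. 293, second identity: `P_{μν}(x) = P_{νμ}(−x)`.  A PREDICATE.
[cite: Balaban1987RG1, (5.8) p.293] -/
def TorusIndexSymmetric (P : Fin d → Fin d → Beta.Site d s → ℝ) : Prop :=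
  ∀ μ ν x, P μ ν x = P ν μ (-x)

end Torus

/-! ## §2 The residue map `siteOf : ℤ^d → (ZMod s)^d` is compatible with the structure maps
(`siteOf_add`, `siteOf_neg`, `siteOf_sub` are pv04 gen 3's, `Beta/VolumeAffine.lean` / `Beta/VolumeConvolution.lean`,
imported by name) -/

section SiteOf

variable (s : ℕ)

/-- `siteOf 0 = 0`. [folklore] -/
theorem siteOf_zero : siteOf d s (0 : Fin d → ℤ) = 0 := by
  funext i; simp [siteOf]

/-- `siteOf e_μ = ê_μ`. [folklore] -/
theorem siteOf_unitVec (μ : Fin d) : siteOf d s (unitVec μ) = torusUnitVec μ := by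
  funext i
  by_cases h : i = μ <;> simp [siteOf, h]

/-- `siteOf` of the conditional unit vector. [folklore] -/
theorem siteOf_ite_unitVec (μ α : Fin d) :
    siteOf d s (if μ = α then unitVec α else 0) = if μ = α then torusUnitVec α else 0 := by
  split_ifs
  · exact siteOf_unitVec s α
  · exact siteOf_zero s

/-- `siteOf (εz) = ε (siteOf z)`. [folklore] -/
theorem siteOf_axisReflect (α : Fin d) (z : Fin d → ℤ) :
    siteOf d s (axisReflect α z) = torusAxisReflect α (siteOf d s z) := by
  funext i
  by_cases h : i = α <;> simp [siteOf, h]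

end SiteOf

/-! ## §3 Closedness of the four structural predicates under pointwise limits -/

section PushForward

variable {s : ℕ} [NeZero s]

/-- Fibrewise push-forward of a finitely supported `ℤ^d` test function along `siteOf`:
`(pushTest s B f)(w)_μ = Σ_{x ∈ B, siteOf x = w} f(x)_μ`. [folklore] -/
noncomputable def pushTest (s : ℕ) (B : Finset (Fin d → ℤ)) (f : (Fin d → ℤ) → Fin d → ℝ)
    (w : Beta.Site d s) (μ : Fin d) : ℝ :=
  ∑ x ∈ B, if siteOf d s x = w then f x μ else 0

/-- Pairing the push-forward with a torus function = pairing `f` with the function pulled back along `siteOf`.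
[folklore] -/
theorem sum_pushTest_mul (B : Finset (Fin d → ℤ)) (f : (Fin d → ℤ) → Fin d → ℝ) (μ : Fin d)
    (φ : Beta.Site d s → ℝ) :
    ∑ w, pushTest s B f w μ * φ w = ∑ x ∈ B, f x μ * φ (siteOf d s x) := by
  unfold pushTest
  simp_rw [Finset.sum_mul]
  rw [Finset.sum_comm]
  refine Finset.sum_congr rfl fun x _ => ?_
  simp_rw [ite_mul, zero_mul]
  rw [Finset.sum_ite_eq]
  simp

/-- The same pairing with the torus function on the left. [folklore] -/
theorem sum_mul_pushTest (B : Finset (Fin d → ℤ)) (f : (Fin d → ℤ) → Fin d → ℝ) (ν : Fin d)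
    (φ : Beta.Site d s → ℝ) :
    ∑ w, φ w * pushTest s B f w ν = ∑ y ∈ B, φ (siteOf d s y) * f y ν := by
  unfold pushTest
  simp_rw [Finset.mul_sum]
  rw [Finset.sum_comm]
  refine Finset.sum_congr rfl fun y _ => ?_
  simp_rw [mul_ite, mul_zero]
  rw [Finset.sum_ite_eq]
  simp

/-- Interchange of a double outer sum with the double direction sum. [folklore] -/
theorem sum_comm₄ {ι κ : Type*} (A : Finset ι) (A' : Finset κ) (F : ι → κ → Fin d → Fin d → ℝ) :
    ∑ a ∈ A, ∑ b ∈ A', ∑ μ, ∑ ν, F a b μ ν = ∑ μ, ∑ ν, ∑ a ∈ A, ∑ b ∈ A', F a b μ ν := by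
  calc ∑ a ∈ A, ∑ b ∈ A', ∑ μ, ∑ ν, F a b μ ν = ∑ a ∈ A, ∑ μ, ∑ b ∈ A', ∑ ν, F a b μ ν :=
        Finset.sum_congr rfl fun a _ => Finset.sum_comm
    _ = ∑ μ, ∑ a ∈ A, ∑ b ∈ A', ∑ ν, F a b μ ν := Finset.sum_comm
    _ = ∑ μ, ∑ a ∈ A, ∑ ν, ∑ b ∈ A', F a b μ ν :=
        Finset.sum_congr rfl fun μ _ => Finset.sum_congr rfl fun a _ => Finset.sum_comm
    _ = ∑ μ, ∑ ν, ∑ a ∈ A, ∑ b ∈ A', F a b μ ν := Finset.sum_congr rfl fun μ _ => Finset.sum_comm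

/-- THE PUSH-FORWARD IDENTITY: the torus convolution form evaluated at the push-forward of `f` equals the `ℤ^d` form of
`f` with the kernel read through `siteOf` — for EVERY side `s` (no injectivity of `siteOf` on `B` is needed: the
fibres are summed). [folklore] -/
theorem torusForm_pushTest (Q : Fin d → Fin d → Beta.Site d s → ℝ) (B : Finset (Fin d → ℤ))
    (f : (Fin d → ℤ) → Fin d → ℝ) :
    ∑ w, ∑ w', ∑ μ, ∑ ν, pushTest s B f w μ * Q μ ν (w - w') * pushTest s B f w' ν
      = ∑ x ∈ B, ∑ y ∈ B, ∑ μ, ∑ ν, f x μ * Q μ ν (siteOf d s x - siteOf d s y) * f y ν := by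
  rw [sum_comm₄ (Finset.univ : Finset (Beta.Site d s)) Finset.univ, sum_comm₄ B B]
  refine Finset.sum_congr rfl fun μ _ => Finset.sum_congr rfl fun ν _ => ?_
  calc ∑ w, ∑ w', pushTest s B f w μ * Q μ ν (w - w') * pushTest s B f w' ν
      = ∑ w, pushTest s B f w μ * ∑ w', Q μ ν (w - w') * pushTest s B f w' ν := by
        refine Finset.sum_congr rfl fun w _ => ?_
        rw [Finset.mul_sum]
        exact Finset.sum_congr rfl fun w' _ => by ring
    _ = ∑ w, pushTest s B f w μ * ∑ y ∈ B, Q μ ν (w - siteOf d s y) * f y ν := by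
        refine Finset.sum_congr rfl fun w _ => ?_
        rw [sum_mul_pushTest]
    _ = ∑ x ∈ B, f x μ * ∑ y ∈ B, Q μ ν (siteOf d s x - siteOf d s y) * f y ν :=
        sum_pushTest_mul B f μ _
    _ = ∑ x ∈ B, ∑ y ∈ B, f x μ * Q μ ν (siteOf d s x - siteOf d s y) * f y ν := by
        refine Finset.sum_congr rfl fun x _ => ?_
        rw [Finset.mul_sum]
        exact Finset.sum_congr rfl fun y _ => by ring

/-- Consequence at one volume: torus PSD ⇒ the `ℤ^d` form of any finitely supported test function, with the kernel
read through `siteOf`, is `≥ 0`. [folklore] -/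
theorem latticeForm_nonneg_of_torusConvPSD {Q : Fin d → Fin d → Beta.Site d s → ℝ}
    (hQ : TorusConvPSD Q) (B : Finset (Fin d → ℤ)) (f : (Fin d → ℤ) → Fin d → ℝ) :
    0 ≤ ∑ x ∈ B, ∑ y ∈ B, ∑ μ, ∑ ν, f x μ * Q μ ν (siteOf d s (x - y)) * f y ν := by
  have h := hQ (pushTest s B f)
  rw [torusForm_pushTest] at h
  simpa only [siteOf_sub] using h

end PushForward

section Limit

variable {side : ℕ → ℕ} [∀ t, NeZero (side t)]
  {P : (t : ℕ) → Fin d → Fin d → Beta.Site d (side t) → ℝ} {Pinf : B12Beta.Kernel d}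

/-- The limit hypothesis at one lattice point, with the residue map written as `siteOf`. [folklore] -/
theorem tendsto_apply_siteOf (hlim : IsInfiniteVolumeLimit side P Pinf) (μ ν : Fin d) (x : Fin d → ℤ) :
    Tendsto (fun t => P t μ ν (siteOf d (side t) x)) atTop (𝓝 (Pinf μ ν x)) :=
  hlim μ ν x

/-- **(5.9) PASSES TO THE LIMIT.**  Torus Ward identity for the kernels `P t` (eventually in `t`) and pointwise
convergence ⇒ `WardTransversal Pinf`. [cite: Balaban1987RG1, (5.9) p.293] -/
theorem wardTransversal_of_limit (hlim : IsInfiniteVolumeLimit side P Pinf)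
    (hW : ∀ᶠ t in atTop, TorusWardTransversal (P t)) : WardTransversal Pinf := by
  intro ν z
  have h1 : Tendsto (fun t => ∑ μ, (P t μ ν (siteOf d (side t) (z - unitVec μ)) - P t μ ν (siteOf d (side t) z)))
      atTop (𝓝 (∑ μ, (Pinf μ ν (z - unitVec μ) - Pinf μ ν z))) :=
    tendsto_finsetSum _ fun μ _ =>
      (tendsto_apply_siteOf hlim μ ν (z - unitVec μ)).sub (tendsto_apply_siteOf hlim μ ν z)
  have h2 : ∀ᶠ t in atTop,
      ∑ μ, (P t μ ν (siteOf d (side t) (z - unitVec μ)) - P t μ ν (siteOf d (side t) z)) = 0 := by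
    filter_upwards [hW] with t ht
    have h := ht ν (siteOf d (side t) z)
    simpa only [siteOf_sub, siteOf_unitVec] using h
  have h3 : Tendsto (fun _ : ℕ => (0 : ℝ)) atTop (𝓝 (∑ μ, (Pinf μ ν (z - unitVec μ) - Pinf μ ν z))) :=
    h1.congr' h2
  exact (tendsto_nhds_unique h3 tendsto_const_nhds)

/-- **(5.7)–(5.8) PASS TO THE LIMIT.**  Torus reflection covariance (eventually in `t`) and pointwise convergence ⇒
`AxisReflectionCovariant Pinf`. [cite: Balaban1987RG1, (5.7)-(5.8) p.293] -/
theorem axisReflectionCovariant_of_limit (hlim : IsInfiniteVolumeLimit side P Pinf)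
    (hR : ∀ᶠ t in atTop, TorusAxisReflectionCovariant (P t)) : AxisReflectionCovariant Pinf := by
  intro α μ ν z
  set w : Fin d → ℤ :=
    axisReflect α z - (if μ = α then unitVec α else 0) + (if ν = α then unitVec α else 0) with hw
  have h1 : Tendsto (fun t => P t μ ν (siteOf d (side t) w)) atTop (𝓝 (Pinf μ ν w)) :=
    tendsto_apply_siteOf hlim μ ν w
  have h2 : Tendsto (fun t => reflSign α μ * reflSign α ν * P t μ ν (siteOf d (side t) z)) atTop
      (𝓝 (reflSign α μ * reflSign α ν * Pinf μ ν z)) :=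
    (tendsto_apply_siteOf hlim μ ν z).const_mul _
  have h3 : ∀ᶠ t in atTop,
      P t μ ν (siteOf d (side t) w) = reflSign α μ * reflSign α ν * P t μ ν (siteOf d (side t) z) := by
    filter_upwards [hR] with t ht
    rw [← ht α μ ν (siteOf d (side t) z), hw, siteOf_add, siteOf_sub, siteOf_axisReflect,
      siteOf_ite_unitVec, siteOf_ite_unitVec]
  exact tendsto_nhds_unique (h1.congr' h3) h2

/-- **(5.8), second identity, PASSES TO THE LIMIT.** [cite: Balaban1987RG1, (5.8) p.293] -/
theorem indexSymmetric_of_limit (hlim : IsInfiniteVolumeLimit side P Pinf)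
    (hS : ∀ᶠ t in atTop, TorusIndexSymmetric (P t)) : IndexSymmetric Pinf := by
  intro μ ν x
  have h1 : Tendsto (fun t => P t μ ν (siteOf d (side t) x)) atTop (𝓝 (Pinf μ ν x)) :=
    tendsto_apply_siteOf hlim μ ν x
  have h2 : Tendsto (fun t => P t ν μ (siteOf d (side t) (-x))) atTop (𝓝 (Pinf ν μ (-x))) :=
    tendsto_apply_siteOf hlim ν μ (-x)
  have h3 : ∀ᶠ t in atTop, P t μ ν (siteOf d (side t) x) = P t ν μ (siteOf d (side t) (-x)) := by
    filter_upwards [hS] with t ht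
    rw [ht μ ν, siteOf_neg]
  exact tendsto_nhds_unique (h1.congr' h3) h2

/-- **PSD PASSES TO THE LIMIT.**  Torus PSD of the convolution form (eventually in `t`) and pointwise convergence ⇒
`ConvPSD Pinf`: each finite `ℤ^d` form is the limit of the torus forms of the pushed-forward test function
(`latticeForm_nonneg_of_torusConvPSD`), and `[0, ∞)` is closed (`ge_of_tendsto`). [folklore] -/
theorem convPSD_of_limit (hlim : IsInfiniteVolumeLimit side P Pinf)
    (hPSD : ∀ᶠ t in atTop, TorusConvPSD (P t)) : ConvPSD Pinf := by
  intro B f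
  have h1 : Tendsto
      (fun t => ∑ x ∈ B, ∑ y ∈ B, ∑ μ, ∑ ν, f x μ * P t μ ν (siteOf d (side t) (x - y)) * f y ν) atTop
      (𝓝 (∑ x ∈ B, ∑ y ∈ B, ∑ μ, ∑ ν, f x μ * Pinf μ ν (x - y) * f y ν)) :=
    tendsto_finsetSum _ fun x _ => tendsto_finsetSum _ fun y _ => tendsto_finsetSum _ fun μ _ =>
      tendsto_finsetSum _ fun ν _ => ((tendsto_apply_siteOf hlim μ ν (x - y)).const_mul _).mul_const _
  have h2 : ∀ᶠ t in atTop,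
      0 ≤ ∑ x ∈ B, ∑ y ∈ B, ∑ μ, ∑ ν, f x μ * P t μ ν (siteOf d (side t) (x - y)) * f y ν := by
    filter_upwards [hPSD] with t ht
    exact latticeForm_nonneg_of_torusConvPSD ht B f
  exact ge_of_tendsto h1 h2

/-! ## §4 Assembly: the sign of the limit second moment, and the one-loop dictionary -/

/-- **`β ≥ 0` FOR THE INFINITE-VOLUME LIMIT KERNEL FROM TORUS-SIDE DATA.**  Sides `side t → ∞`, pointwise limit
`Pinf` ((1.21) predicate), volume-uniform (5.10)-type decay (`UniformDecay`, the located unprinted input of G-beta-4,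
a hypothesis), and — eventually in the volume — torus Ward identity, torus PSD and torus reflection covariance ⇒
`0 ≤ Σ_z Pinf_{αβ}(z) z_α z_β` for `α ≠ β`.  Composition of (k3)'s `secondMoment_nonneg_of_decay510` with pv01's
`decay510_of_isInfiniteVolumeLimit` and §3. [cite: Balaban1987RG1, (1.22) p.264] -/
theorem secondMoment_nonneg_of_limit (hside : Tendsto side atTop atTop) (hlim : IsInfiniteVolumeLimit side P Pinf)
    {C δ : ℝ} (hδ : 0 < δ) (hdec : UniformDecay side P C δ)
    (hW : ∀ᶠ t in atTop, TorusWardTransversal (P t)) (hPSD : ∀ᶠ t in atTop, TorusConvPSD (P t))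
    (hR : ∀ᶠ t in atTop, TorusAxisReflectionCovariant (P t)) {α β : Fin d} (hαβ : α ≠ β) :
    0 ≤ B12Beta.secondMoment Pinf α β :=
  secondMoment_nonneg_of_decay510 hδ (fun μ ν => decay510_of_isInfiniteVolumeLimit hside hlim hdec μ ν)
    (wardTransversal_of_limit hlim hW) (convPSD_of_limit hlim hPSD) (axisReflectionCovariant_of_limit hlim hR) hαβ

/-- The second-moment FORMULA for the limit kernel from torus-side data (PSD not needed):
`β_{αβ} = −½ Σ_z Pinf_{ββ}(z) z_α²`. [cite: Balaban1987RG1, (1.22) p.264] -/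
theorem secondMoment_eq_neg_half_of_limit (hside : Tendsto side atTop atTop)
    (hlim : IsInfiniteVolumeLimit side P Pinf) {C δ : ℝ} (hδ : 0 < δ) (hdec : UniformDecay side P C δ)
    (hW : ∀ᶠ t in atTop, TorusWardTransversal (P t)) (hR : ∀ᶠ t in atTop, TorusAxisReflectionCovariant (P t))
    {α β : Fin d} (hαβ : α ≠ β) :
    B12Beta.secondMoment Pinf α β = -(1 / 2) * ∑' z, Pinf β β z * (z α : ℝ) ^ 2 :=
  secondMoment_eq_neg_half
    (momentSummable_of_decay510 hδ (fun μ ν => decay510_of_isInfiniteVolumeLimit hside hlim hdec μ ν) 3)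
    (wardTransversal_of_limit hlim hW) hαβ
    (first_moment_eq_zero (axisReflectionCovariant_of_limit hlim hR) hαβ)

/-- The finite-volume numbers follow: under the hypotheses of `secondMoment_nonneg_of_limit` the torus second
moments (pv25's `torusSecondMoment`, which converge to the limit second moment by pv01's `tendsto_torusSecondMoment`)
are eventually `> −ε` for every `ε > 0`. [folklore] -/
theorem eventually_torusSecondMoment_gt (hside : Tendsto side atTop atTop)
    (hlim : IsInfiniteVolumeLimit side P Pinf) {C δ : ℝ} (hδ : 0 < δ) (hdec : UniformDecay side P C δ)
    (hW : ∀ᶠ t in atTop, TorusWardTransversal (P t)) (hPSD : ∀ᶠ t in atTop, TorusConvPSD (P t))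
    (hR : ∀ᶠ t in atTop, TorusAxisReflectionCovariant (P t)) {α β : Fin d} (hαβ : α ≠ β)
    {ε : ℝ} (hε : 0 < ε) :
    ∀ᶠ t in atTop, -ε < torusSecondMoment (P t) α β := by
  have h0 := secondMoment_nonneg_of_limit hside hlim hδ hdec hW hPSD hR hαβ
  have hlt : -ε < B12Beta.secondMoment Pinf α β := by linarith
  exact (tendsto_torusSecondMoment hside hlim hδ hdec α β).eventually (lt_mem_nhds hlt)

end Limit

end Literature.MathematicalPhysics.QuantumFieldTheory.Balaban1983to89.Beta.PolarizationLimit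

/-! ### The corollary over pv25's `OneLoopDictionary` (dot-notation addition to `…Beta.OneLoopDictionary`) -/

namespace Literature.MathematicalPhysics.QuantumFieldTheory.Balaban1983to89.Beta

open Literature.MathematicalPhysics.QuantumFieldTheory.Balaban1983to89
open Literature.MathematicalPhysics.QuantumFieldTheory.Balaban1983to89.Beta.PolarizationSign
open Literature.MathematicalPhysics.QuantumFieldTheory.Balaban1983to89.Beta.PolarizationLimit
open _root_.Filter
open scoped _root_.Topology

variable {d c : ℕ} {β : (k : ℕ) → (Fin (k + 1) → ℝ) → ℝ} {S : B12Beta.OneLoopSplit β}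

/-- **`0 ≤ β⁰_k` FROM TORUS-SIDE STRUCTURE.**  For pv25's hypothesis carrier `D` ((1.21) `isLimit`, (1.22)
`beta0_eq`), a scale `k` with torus sides `D.side k t → ∞`, volume-uniform (5.10)-type decay of the one-loop torus
kernels at a colour `a`, and — eventually in `t` — the torus Ward identity, torus PSD of the convolution form and torus
reflection covariance of those kernels: the abstract one-loop coefficient satisfies `0 ≤ S.β0 k`.  (The weak half of
(AF-0); nothing about Bałaban's kernels is asserted — every property is a hypothesis on the dictionary's torus
families, to be verified by the rows that build them.) [cite: Balaban1987RG1, (1.22) p.264] -/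
theorem OneLoopDictionary.beta0_nonneg_of_torus (D : OneLoopDictionary d c S) (k : ℕ) (a : Fin c)
    (hside : Tendsto (D.side k) atTop atTop) {C δ : ℝ} (hδ : 0 < δ)
    (hdec : UniformDecay (D.side k) (fun t => torusKernel (D.model k t) a) C δ)
    (hW : ∀ᶠ t in atTop, TorusWardTransversal (torusKernel (D.model k t) a))
    (hPSD : ∀ᶠ t in atTop, TorusConvPSD (torusKernel (D.model k t) a))
    (hR : ∀ᶠ t in atTop, TorusAxisReflectionCovariant (torusKernel (D.model k t) a))
    {μ ν : Fin d} (hμν : μ ≠ ν) : 0 ≤ S.β0 k := by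
  rw [D.beta0_eq k μ ν hμν]
  exact secondMoment_nonneg_of_limit hside (D.isLimit' k a) hδ hdec hW hPSD hR hμν

/-- The same for every scale at once: if the torus-side structure and the volume-uniform decay hold at every scale
`k` (each with its own constants), then `∀ k, 0 ≤ S.β0 k` — the SIGN input of the β sub-cell's flow analysis in its
weakest form (no uniformity, no rate, no strict positivity). [cite: Balaban1987RG1, (1.22) p.264] -/
theorem OneLoopDictionary.beta0_nonneg_all (D : OneLoopDictionary d c S) (a : Fin c) {μ ν : Fin d} (hμν : μ ≠ ν)
    (hside : ∀ k, Tendsto (D.side k) atTop atTop)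
    (hdec : ∀ k, ∃ C δ : ℝ, 0 < δ ∧ UniformDecay (D.side k) (fun t => torusKernel (D.model k t) a) C δ)
    (hW : ∀ k, ∀ᶠ t in atTop, TorusWardTransversal (torusKernel (D.model k t) a))
    (hPSD : ∀ k, ∀ᶠ t in atTop, TorusConvPSD (torusKernel (D.model k t) a))
    (hR : ∀ k, ∀ᶠ t in atTop, TorusAxisReflectionCovariant (torusKernel (D.model k t) a)) :
    ∀ k, 0 ≤ S.β0 k := fun k => by
  obtain ⟨C, δ, hδ, hd⟩ := hdec k
  exact D.beta0_nonneg_of_torus k a (hside k) hδ hd (hW k) (hPSD k) (hR k) hμν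

end Literature.MathematicalPhysics.QuantumFieldTheory.Balaban1983to89.Beta
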